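import Summits.QuantumFields.YangMills.Theorems.NPointIsotropy.Negative.DegreeTwoFree
import Literature.MathematicalPhysics.QuantumLattice.SchwartzLocalDensity
import HarnessLib

/-!
# `NPointIsotropy` — degrees `≤ 2` of the finite harmonic kill (support for stmt-QuantumFields-11686)

Support file for crux `stmt-QuantumFields-11686` (`PencilRigidity.NPointIsotropy`), line
`complex-rotation-bandlimit`, sub-goal `harmonicKill_degree_le_two` of the lead's stub
`stub_harmonicKill`: a translation-invariant one-species Schwinger family on `ℝ⁴` with the radial
two-point kernel and a function residual off the diagonals is invariant in degrees `n ≤ 2`, on `⁰𝒮`,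
under EVERY linear isometry of `ℝ⁴`.

* `n = 0`: `Fin 0 → ℝ⁴` is a one-point space, so `linActMulti R F = F`.
* `n = 1`: `⁰𝒮 = 𝒮` in degree one (no pair `i ≠ j` in `Fin 1`), so translation invariance and the
  function residual are unconditional, and a translation-invariant functional with a function
  residual is `c · dx` (`DegreeLeTwo.degreeOne_constMultiple`, the same theorem and proof as the
  sibling support file `PencilRigidityNPointIsotropyDegreeOne` / `translationInvariant_degreeOne`,
  repeated here under its own name so that this file elaborates independently of that file's build);
  Lebesgue measure on `Fin 1 → ℝ⁴` is invariant under `x ↦ (R⁻¹ xᵢ)ᵢ`.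
* `n = 2`: the landed `radialKernel_invariant_two` (radial kernel + invariance of Lebesgue measure).
[folklore]
-/

noncomputable section

open scoped BigOperators SchwartzMap
open MeasureTheory Filter Topology
open Literature.MathematicalPhysics.QuantumLattice Literature.MathematicalPhysics.AQFT
open Summit.QuantumFields.YangMills.Theorems.NPointIsotropy.Negative (E4 radialKernel_invariant_two)

namespace Summit.QuantumFields.YangMills.Theorems.NPointIsotropy.ComplexRotationBandlimit

namespace DegreeLeTwo

/-! ## Degree one: a translation-invariant functional with a function residual is `c · dx`

For compactly supported Schwartz `φ, ψ` the double integral `∫∫ W x φ(x - y) ψ(y) dy dx` equals both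
`S φ ∫ ψ` (do the `x`-integral first and use translation invariance) and `S ψ ∫ φ` (substitute
`y ↦ x - y` first); with `∫ φ₀ = 1` this gives `S ψ = S φ₀ ∫ ψ` on compactly supported `ψ`, and the
compactly supported cutoffs (`exists_cutoff_seq`) plus dominated convergence extend it to `𝓢`.
-/

/-! ## Instances on `Fin 1 → ℝ⁴` (`E4 = EuclideanSpace ℝ (Fin 4)`) that instance search does not find -/

/-- Lebesgue measure on `Fin 1 → ℝ⁴` has temperate growth. [folklore] -/
private theorem hasTemperateGrowth_volume_pi_one : (volume : Measure (Fin 1 → E4)).HasTemperateGrowth :=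
  Measure.IsAddHaarMeasure.instHasTemperateGrowth

/-- Lebesgue measure on `Fin 1 → ℝ⁴` is invariant under `x ↦ -x`. [folklore] -/
private theorem isNegInvariant_volume_pi_one : (volume : Measure (Fin 1 → E4)).IsNegInvariant :=
  haveI : (volume : Measure (Fin 1 → E4)).Regular :=
    Measure.Regular.of_sigmaCompactSpace_of_isLocallyFiniteMeasure _
  Measure.IsAddHaarMeasure.isNegInvariant_of_regular _

/-! ## Translation invariance read on the representing function -/

/-- On `Fin 1 → E` the diagonal translation by `y 0` is the translation by `y`. [folklore] -/
private theorem translateMulti_apply_fin_one (y : (Fin 1 → E4)) (φ : 𝓢((Fin 1 → E4), ℂ)) (x : (Fin 1 → E4)) :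
    translateMulti (y 0) φ x = φ (x - y) := by
  rw [translateMulti_apply]
  congr 1
  funext i
  rw [Subsingleton.elim i 0]
  rfl

/-- Translation invariance plus the function residual: `∫ W x · φ(x - y) dx = S φ` for every `y`,
with an integrable integrand. [folklore] -/
private theorem integral_mul_translate_eq {S : 𝓢((Fin 1 → E4), ℂ) →L[ℂ] ℂ} {W : (Fin 1 → E4) → ℂ}
    (hT : ∀ (a : EuclideanSpace ℝ (Fin 4)) (F : 𝓢((Fin 1 → E4), ℂ)), S (translateMulti a F) = S F)
    (hW : ∀ F : 𝓢((Fin 1 → E4), ℂ), Integrable (fun x => W x * F x) ∧ S F = ∫ x, W x * F x)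
    (φ : 𝓢((Fin 1 → E4), ℂ)) (y : (Fin 1 → E4)) :
    Integrable (fun x => W x * φ (x - y)) ∧ ∫ x, W x * φ (x - y) = S φ := by
  have hfun : (fun x => W x * translateMulti (y 0) φ x) = fun x => W x * φ (x - y) := by
    funext x
    rw [translateMulti_apply_fin_one]
  obtain ⟨hi, hS⟩ := hW (translateMulti (y 0) φ)
  rw [hfun] at hi hS
  exact ⟨hi, by rw [← hS, hT]⟩

/-! ## The double integral -/

/-- **Key computation.** For compactly supported Schwartz `φ, ψ`:
`∫ W x (∫ φ(x - y) ψ(y) dy) dx = S φ · ∫ ψ` (Fubini, then translation invariance in `x`). [folklore] -/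
private theorem integral_mul_integral_eq {S : 𝓢((Fin 1 → E4), ℂ) →L[ℂ] ℂ} {W : (Fin 1 → E4) → ℂ}
    (hT : ∀ (a : EuclideanSpace ℝ (Fin 4)) (F : 𝓢((Fin 1 → E4), ℂ)), S (translateMulti a F) = S F)
    (hW : ∀ F : 𝓢((Fin 1 → E4), ℂ), Integrable (fun x => W x * F x) ∧ S F = ∫ x, W x * F x)
    (φ ψ : 𝓢((Fin 1 → E4), ℂ)) (hφ : HasCompactSupport (φ : _ → ℂ))
    (hψ : HasCompactSupport (ψ : _ → ℂ)) :
    ∫ x, W x * ∫ y, φ (x - y) * ψ y = S φ * ∫ y, ψ y := by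
  haveI : (volume : Measure (Fin 1 → E4)).HasTemperateGrowth := hasTemperateGrowth_volume_pi_one
  -- a common radius for the two supports
  obtain ⟨R, hR⟩ := (hφ.isCompact.union hψ.isCompact).isBounded.subset_closedBall (0 : (Fin 1 → E4))
  -- a bump equal to one on `closedBall 0 (2|R|+1) ⊇ supp ψ + supp φ`
  let χ : ContDiffBump (0 : (Fin 1 → E4)) := ⟨2 * |R| + 1, 2 * |R| + 2, by positivity, by linarith⟩
  have hχ1 : ∀ x y : (Fin 1 → E4), φ (x - y) * ψ y ≠ 0 → (χ : (Fin 1 → E4) → ℝ) x = 1 := by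
    intro x y h
    have hy : y ∈ tsupport (ψ : _ → ℂ) := subset_tsupport _ (right_ne_zero_of_mul h)
    have hxy : x - y ∈ tsupport (φ : _ → ℂ) := subset_tsupport _ (left_ne_zero_of_mul h)
    have h1 : ‖y‖ ≤ |R| := (mem_closedBall_zero_iff.1 (hR (Or.inr hy))).trans (le_abs_self R)
    have h2 : ‖x - y‖ ≤ |R| := (mem_closedBall_zero_iff.1 (hR (Or.inl hxy))).trans (le_abs_self R)
    apply χ.one_of_mem_closedBall
    rw [mem_closedBall_zero_iff]
    calc ‖x‖ = ‖(x - y) + y‖ := by rw [sub_add_cancel]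
      _ ≤ ‖x - y‖ + ‖y‖ := norm_add_le _ _
      _ ≤ 2 * |R| + 1 := by linarith
  have hgc : HasCompactSupport (fun x => ((χ : (Fin 1 → E4) → ℝ) x : ℂ)) :=
    χ.hasCompactSupport.comp_left Complex.ofReal_zero
  have hgs : ContDiff ℝ (⊤ : ℕ∞) (fun x => ((χ : (Fin 1 → E4) → ℝ) x : ℂ)) :=
    Complex.ofRealCLM.contDiff.comp χ.contDiff
  let g : 𝓢((Fin 1 → E4), ℂ) := hgc.toSchwartzMap hgs
  have hg_apply : ∀ x : (Fin 1 → E4), g x = ((χ : (Fin 1 → E4) → ℝ) x : ℂ) := fun x => rfl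
  have hpt : ∀ x y : (Fin 1 → E4), W x * (φ (x - y) * ψ y) = (W x * g x) * (φ (x - y) * ψ y) := by
    intro x y
    by_cases h : φ (x - y) * ψ y = 0
    · simp [h]
    · rw [hg_apply, hχ1 x y h]
      push_cast
      ring
  -- integrability on the product
  obtain ⟨C, hC⟩ := hφ.exists_bound_of_continuous φ.continuous
  have hWg : Integrable (fun x => W x * g x) := (hW g).1
  have hint : Integrable (Function.uncurry fun x y : (Fin 1 → E4) => W x * (φ (x - y) * ψ y))
      ((volume : Measure (Fin 1 → E4)).prod volume) := by
    have hdom : Integrable (fun p : (Fin 1 → E4) × (Fin 1 → E4) => ‖W p.1 * g p.1‖ * (C * ‖ψ p.2‖))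
        ((volume : Measure (Fin 1 → E4)).prod volume) :=
      hWg.norm.mul_prod (ψ.integrable.norm.const_mul C)
    refine hdom.mono' ?_ (ae_of_all _ fun p => ?_)
    · have h1 : AEStronglyMeasurable (fun p : (Fin 1 → E4) × (Fin 1 → E4) => W p.1 * g p.1)
          ((volume : Measure (Fin 1 → E4)).prod volume) := hWg.aestronglyMeasurable.comp_fst
      have h2 : Continuous (fun p : (Fin 1 → E4) × (Fin 1 → E4) => φ (p.1 - p.2) * ψ p.2) := by fun_prop
      refine (h1.mul h2.aestronglyMeasurable).congr (ae_of_all _ fun p => ?_)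
      exact (hpt p.1 p.2).symm
    · change ‖W p.1 * (φ (p.1 - p.2) * ψ p.2)‖ ≤ ‖W p.1 * g p.1‖ * (C * ‖ψ p.2‖)
      rw [hpt p.1 p.2, norm_mul, norm_mul (φ _)]
      gcongr
      exact hC _
  -- the `x`-integral first
  have hinner : ∀ y : (Fin 1 → E4), ∫ x, W x * (φ (x - y) * ψ y) = S φ * ψ y := by
    intro y
    simp_rw [← mul_assoc]
    rw [integral_mul_const, (integral_mul_translate_eq hT hW φ y).2]
  calc ∫ x, W x * ∫ y, φ (x - y) * ψ y
      = ∫ x, ∫ y, W x * (φ (x - y) * ψ y) := by simp_rw [integral_const_mul]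
    _ = ∫ y, ∫ x, W x * (φ (x - y) * ψ y) := integral_integral_swap hint
    _ = ∫ y, S φ * ψ y := by simp_rw [hinner]
    _ = S φ * ∫ y, ψ y := integral_const_mul _ _

/-- **Symmetry.** `S φ · ∫ ψ = S ψ · ∫ φ` for compactly supported Schwartz `φ, ψ`: the inner integral
of `integral_mul_integral_eq` is symmetric under `y ↦ x - y`. [folklore] -/
private theorem apply_mul_integral_comm {S : 𝓢((Fin 1 → E4), ℂ) →L[ℂ] ℂ} {W : (Fin 1 → E4) → ℂ}
    (hT : ∀ (a : EuclideanSpace ℝ (Fin 4)) (F : 𝓢((Fin 1 → E4), ℂ)), S (translateMulti a F) = S F)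
    (hW : ∀ F : 𝓢((Fin 1 → E4), ℂ), Integrable (fun x => W x * F x) ∧ S F = ∫ x, W x * F x)
    (φ ψ : 𝓢((Fin 1 → E4), ℂ)) (hφ : HasCompactSupport (φ : _ → ℂ))
    (hψ : HasCompactSupport (ψ : _ → ℂ)) :
    S φ * ∫ y, ψ y = S ψ * ∫ y, φ y := by
  haveI : (volume : Measure (Fin 1 → E4)).IsNegInvariant := isNegInvariant_volume_pi_one
  rw [← integral_mul_integral_eq hT hW φ ψ hφ hψ, ← integral_mul_integral_eq hT hW ψ φ hψ hφ]
  congr 1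
  funext x
  congr 1
  rw [← integral_sub_left_eq_self (fun y : (Fin 1 → E4) => ψ (x - y) * φ y) volume x]
  congr 1
  funext y
  rw [sub_sub_cancel, mul_comm]

/-- A compactly supported Schwartz function on `Fin 1 → ℝ⁴` with integral one (a normalised bump).
[folklore] -/
private theorem exists_hasCompactSupport_integral_eq_one :
    ∃ φ : 𝓢((Fin 1 → E4), ℂ), HasCompactSupport (φ : _ → ℂ) ∧ ∫ x, φ x = 1 := by
  let χ : ContDiffBump (0 : (Fin 1 → E4)) := ⟨1, 2, one_pos, one_lt_two⟩
  have hc : HasCompactSupport (fun x => ((χ.normed volume x : ℝ) : ℂ)) :=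
    χ.hasCompactSupport_normed.comp_left Complex.ofReal_zero
  have hs : ContDiff ℝ (⊤ : ℕ∞) (fun x => ((χ.normed volume x : ℝ) : ℂ)) :=
    Complex.ofRealCLM.contDiff.comp χ.contDiff_normed
  refine ⟨hc.toSchwartzMap hs, hc, ?_⟩
  change ∫ x, ((χ.normed volume x : ℝ) : ℂ) = 1
  rw [integral_complex_ofReal, χ.integral_normed]
  simp

/-- **Degree one of the finite harmonic kill** (same statement and proof as the sibling sub-goal
`translationInvariant_degreeOne`, kept here so that this file does not depend on the sibling's build).
A translation-invariant continuous linear functional on `𝓢((Fin 1 → ℝ⁴), ℂ)` represented by a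
function is a constant multiple of Lebesgue measure. [folklore] -/
private theorem degreeOne_constMultiple :
    ∀ (S₁ : Literature.MathematicalPhysics.QuantumLattice.SchwingerFamily (EuclideanSpace ℝ (Fin 4))),
      (∀ (a : EuclideanSpace ℝ (Fin 4)) (F : SchwartzMap (Fin 1 → EuclideanSpace ℝ (Fin 4)) ℂ),
        S₁ 1 (Literature.MathematicalPhysics.QuantumLattice.translateMulti a F) = S₁ 1 F) →
      (∃ W : (Fin 1 → EuclideanSpace ℝ (Fin 4)) → ℂ,
        ∀ F : SchwartzMap (Fin 1 → EuclideanSpace ℝ (Fin 4)) ℂ,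
          MeasureTheory.Integrable (fun x : Fin 1 → EuclideanSpace ℝ (Fin 4) => W x * F x) ∧
            S₁ 1 F = ∫ x : Fin 1 → EuclideanSpace ℝ (Fin 4), W x * F x) →
      ∃ c : ℂ, ∀ F : SchwartzMap (Fin 1 → EuclideanSpace ℝ (Fin 4)) ℂ,
        S₁ 1 F = c * ∫ x : Fin 1 → EuclideanSpace ℝ (Fin 4), F x := by
  intro S₁ hT hres
  obtain ⟨W, hW⟩ := hres
  haveI : (volume : Measure (Fin 1 → E4)).HasTemperateGrowth := hasTemperateGrowth_volume_pi_one
  obtain ⟨φ₀, hφ₀c, hφ₀i⟩ := exists_hasCompactSupport_integral_eq_one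
  refine ⟨S₁ 1 φ₀, fun F => ?_⟩
  -- compactly supported test functions
  have hcs : ∀ ψ : 𝓢((Fin 1 → E4), ℂ), HasCompactSupport (ψ : (Fin 1 → E4) → ℂ) →
      S₁ 1 ψ = S₁ 1 φ₀ * ∫ x : (Fin 1 → E4), ψ x := by
    intro ψ hψ
    have h := apply_mul_integral_comm hT hW φ₀ ψ hφ₀c hψ
    rw [hφ₀i, mul_one] at h
    exact h.symm
  -- general test functions: compactly supported cutoffs and dominated convergence
  obtain ⟨u, hu, -, hule, hupt, hlim⟩ := exists_cutoff_seq F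
  have h1 : Tendsto (fun m => S₁ 1 (u m)) atTop (𝓝 (S₁ 1 F)) := ((S₁ 1).continuous.tendsto F).comp hlim
  have h2 : Tendsto (fun m => ∫ x : (Fin 1 → E4), u m x) atTop (𝓝 (∫ x : (Fin 1 → E4), F x)) :=
    tendsto_integral_of_dominated_convergence (fun x => ‖F x‖)
      (fun m => (u m).continuous.aestronglyMeasurable) F.integrable.norm
      (fun m => ae_of_all _ (hule m)) (ae_of_all _ hupt)
  have h3 : Tendsto (fun m => S₁ 1 (u m)) atTop (𝓝 (S₁ 1 φ₀ * ∫ x : (Fin 1 → E4), F x)) := by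
    have heq : (fun m => S₁ 1 (u m)) = fun m => S₁ 1 φ₀ * ∫ x : (Fin 1 → E4), u m x :=
      funext fun m => hcs _ (hu m)
    rw [heq]
    exact h2.const_mul _
  exact tendsto_nhds_unique h1 h3

/-! ## Degrees `0`, `1`, `2` -/

/-- Change of variables by an isometry acting diagonally on `n`-point configurations (Lebesgue
measure on `(ℝ⁴)ⁿ` is invariant). [folklore] -/
theorem integral_comp_isometry_pi (n : ℕ) (R : E4 ≃ₗᵢ[ℝ] E4) (g : (Fin n → E4) → ℂ) :
    ∫ x : Fin n → E4, g (fun i => R.symm (x i)) = ∫ y : Fin n → E4, g y := by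
  have hmp : MeasurePreserving (fun (x : Fin n → E4) (i : Fin n) => R.symm (x i)) :=
    volume_preserving_pi fun _ => R.symm.measurePreserving
  have hme : MeasurableEmbedding (fun (x : Fin n → E4) (i : Fin n) => R.symm (x i)) :=
    (MeasurableEquiv.piCongrRight fun _ : Fin n => R.symm.toHomeomorph.toMeasurableEquiv).measurableEmbedding
  exact hmp.integral_comp hme g

/-- In degree one every test function is off-diagonal: `Fin 1` has no pair `i ≠ j`. [folklore] -/
theorem isOffDiagonal_fin_one (F : 𝓢((Fin 1 → E4), ℂ)) : IsOffDiagonal F := by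
  intro x hx
  obtain ⟨i, j, hij, -⟩ := hx
  exact absurd (Subsingleton.elim i j) hij

/-- In degree zero the diagonal action is trivial: `Fin 0 → ℝ⁴` is a one-point space. [folklore] -/
theorem linActMulti_fin_zero (R : E4 ≃ₗᵢ[ℝ] E4) (F : 𝓢((Fin 0 → E4), ℂ)) : linActMulti R F = F := by
  ext x
  rw [linActMulti_apply]
  congr 1
  funext i
  exact Fin.elim0 i

/-- Degree one: a translation-invariant functional with a function residual is `c · dx`, hence
invariant under every linear isometry. [folklore] -/
theorem invariant_one {S₁ : SchwingerFamily E4}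
    (hT : ∀ (a : E4) (F : 𝓢((Fin 1 → E4), ℂ)), S₁ 1 (translateMulti a F) = S₁ 1 F)
    (hres : ∃ W : (Fin 1 → E4) → ℂ, ∀ F : 𝓢((Fin 1 → E4), ℂ),
      Integrable (fun x : Fin 1 → E4 => W x * F x) ∧ S₁ 1 F = ∫ x : Fin 1 → E4, W x * F x)
    (R : E4 ≃ₗᵢ[ℝ] E4) (F : 𝓢((Fin 1 → E4), ℂ)) : S₁ 1 (linActMulti R F) = S₁ 1 F := by
  obtain ⟨c, hc⟩ := degreeOne_constMultiple S₁ hT hres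
  rw [hc, hc]
  congr 1
  have hpt : (fun x : Fin 1 → E4 => (linActMulti R F) x) = fun x : Fin 1 → E4 => F (fun i => R.symm (x i)) := by
    funext x
    rw [linActMulti_apply]
  rw [hpt]
  exact integral_comp_isometry_pi 1 R (F : (Fin 1 → E4) → ℂ)

end DegreeLeTwo

/-- **Degrees `≤ 2` of the finite harmonic kill** (registered sub-goal of stub `stub_harmonicKill`).
[folklore] -/
theorem harmonicKill_degree_le_two :
    ∀ (S₁ : Literature.MathematicalPhysics.QuantumLattice.SchwingerFamily (EuclideanSpace ℝ (Fin 4))),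
      Summit.QuantumFields.YangMills.Theorems.CurvatureBoostCovariance.Negative.Translations S₁ →
      Summit.QuantumFields.YangMills.Theorems.NPointIsotropy.Negative.RadialKernel S₁ →
      (∀ n : ℕ, ∃ W : (Fin n → EuclideanSpace ℝ (Fin 4)) → ℂ,
        ∀ F : SchwartzMap (Fin n → EuclideanSpace ℝ (Fin 4)) ℂ,
          Literature.MathematicalPhysics.AQFT.IsOffDiagonal F →
            MeasureTheory.Integrable (fun x : Fin n → EuclideanSpace ℝ (Fin 4) => W x * F x) ∧
              S₁ n F = ∫ x : Fin n → EuclideanSpace ℝ (Fin 4), W x * F x) →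
      ∀ (R : EuclideanSpace ℝ (Fin 4) ≃ₗᵢ[ℝ] EuclideanSpace ℝ (Fin 4)) (n : ℕ), n ≤ 2 →
        ∀ F : SchwartzMap (Fin n → EuclideanSpace ℝ (Fin 4)) ℂ, Literature.MathematicalPhysics.AQFT.IsOffDiagonal F →
          S₁ n (Literature.MathematicalPhysics.QuantumLattice.linActMulti R F) = S₁ n F := by
  intro S₁ hT hK hres R n hn
  interval_cases n
  · intro F _
    rw [DegreeLeTwo.linActMulti_fin_zero]
  · intro F _
    have hT1 : ∀ (a : E4) (G : 𝓢((Fin 1 → E4), ℂ)), S₁ 1 (translateMulti a G) = S₁ 1 G :=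
      fun a G => hT 1 a G (DegreeLeTwo.isOffDiagonal_fin_one G)
    have hres1 : ∃ W : (Fin 1 → E4) → ℂ, ∀ G : 𝓢((Fin 1 → E4), ℂ),
        Integrable (fun x : Fin 1 → E4 => W x * G x) ∧ S₁ 1 G = ∫ x : Fin 1 → E4, W x * G x := by
      obtain ⟨W, hW⟩ := hres 1
      exact ⟨W, fun G => hW G (DegreeLeTwo.isOffDiagonal_fin_one G)⟩
    exact DegreeLeTwo.invariant_one hT1 hres1 R F
  · intro F hF
    exact radialKernel_invariant_two hK R F hF

end Summit.QuantumFields.YangMills.Theorems.NPointIsotropy.ComplexRotationBandlimit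

end
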